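import Summits.HodgeConjecture.HodgeConjecture.Theorems.K2E1ConstantLineResidualU2        -- ★ (K2E4-p14 g6) rank-generic: `span_const_le_residualSubspace (𝒢) (μ) (𝔓) (hmean)`, `span_const_le_discreteSpectrum`
import Summits.HodgeConjecture.HodgeConjecture.Theorems.K2E1CuspFormsMeanZeroCMThree      -- ★ (R-d1)₃ p859084 (K2E4-p14 g7): `hmean_three_of_smoothing_decay` («cusp forms have mean zero» at `N = 3` modulo `hRc`, `hsm`)
import HarnessLib

/-!
# K2·E1 — `K2E1ConstantLineResidualU3` (road (ρ2)₃ «G7 PROPER» at `N = 3`): THE CONSTANT LINE IS RESIDUAL ON `U(J₃)(F)∖U(J₃)(𝔸_F)` —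
# `ℂ·𝟙 ≤ L²_res = L²_disc ⊓ (L²_cusp)ᗮ` MODULO THE (R-c)₃ LETTER AND THE DECAY LETTER ON `S_η S_Θ φ`

Track B ∕ K2-LIT, crux h413 = `stmt-HodgeConjecture-24833`, route of record `HCCMUnconditional`; cell `hodgecm-mathlib`, squad K2, ENGINE E1.  Prover seat `hodgecm-mathlib-K2-defs1` (g6);
TABLE 11th §F order «K2-defs1 (g6): (R-b)₃ → (ρ1)₃∕(ρ2)₃ `K2E1ConstantLineResidualU3`».  THEOREMS ONLY (no `def`, no `instance`, no notation, no named-fact hypothesis, no `sorry`);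
lane `--supports stmt-HodgeConjecture-24833 --as helper` (count-neutral).  Closes no socket.  RANK-3 GENERIC in the quadratic datum `(F, E, c)`, `c² = 1`.

THE COMPOSITION.  ★ `K2E1ConstantLineResidualU2.span_const_le_residualSubspace` is rank-generic (ANY `AdelicGroupData`): `ℂ ∙ 𝟙 ≤ L²_res(𝒢, μ, 𝔓)` modulo the single letter
`hmean : ∀ φ ∈ cuspForms μ 𝔓, ∫ φ dμ = 0`.  At `N = 3`, ★ (R-d1)₃ `hmean_three_of_smoothing_decay` pays `hmean` on `U(J₃)(F)∖U(J₃)(𝔸_F)` modulo the (R-c)₃ letter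
`hRc : ∀ ψ, Continuous ψ → ConstantTermVanishes 𝔓 ψ i → Integrable (w₁^A·‖ψ‖) μ → ∫ ψ dμ = 0` (payer: (R-c)₃ `K2E1CuspFormsMeanZeroDecayingCMThree` ∘ (R-b)₃ ★
`residue_uniform_majorant_cm_three_of_pole` ∘ the `N = 3` residue limit) and the decay letter `hsm` on `S_η S_Θ φ` (payer: (2b)₃-𝔛), for parabolic data `𝔓` whose `i`-th radical is
the Heisenberg radical `N(𝔸)` and smoothing kernels `η, Θ ∈ C_c(G(𝔸))` of non-zero mass.  This file is the one-line composition, so that the (ρ2)₃ rung is BY NAME on exactly those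
two letters; clause (i) `ℂ ∙ 𝟙 ≤ L²_disc` is letter-free (★ `span_const_le_discreteSpectrum`).

* §1 **`span_const_le_residualSubspace_three_of_smoothing_decay (hc) (μ) (νG) (𝔓) (i) (h𝔓) (hRc) (hη hηs hΘ hΘs hη0 hΘ0) (hsm)`** — `ℂ ∙ 𝟙 ≤ L²_res(U(J₃), μ, 𝔓)`;
  `span_const_le_discreteSpectrum_three` (clause (i), letter-free); `const_one_mem_residualSubspace_three_of_smoothing_decay` (the element form `𝟙 ∈ L²_res`).
* §2 the CM pair `L ∕ L⁺` (`c = complexConj`, `c² = 1` discharged): **`span_const_le_residualSubspace_cm_three_of_smoothing_decay`**.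
HONEST LABEL: HC_CM is proved only modulo the 7 printed citations (2 remaining named inputs: hLiu418 = `stmt-HodgeConjecture-24832`, h413 = `stmt-HodgeConjecture-24833`) until rung 0
closes; this file asserts no named fact and closes no socket; it is CONDITIONAL by construction on the displayed letters `hRc` ((R-c)₃) and `hsm` (decay of `S_η S_Θ φ`).
References: [MoeglinWaldspurger1995] I.2.6, I.2.18 · [BorelJacquet1979] §4.4–§4.6 · [Rogawski1990] §2.1, §13.5.
-/

set_option autoImplicit false
-- the mandated namespace repeats the single-problem summit's segment (`HodgeConjecture.HodgeConjecture`)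
set_option linter.dupNamespace false

noncomputable section

open MeasureTheory Measure NumberField IsDedekindDomain Set Filter Module MulAction
open scoped ENNReal NNReal Topology Classical
open Literature.NumberTheory
open Literature.NumberTheory.Automorphic Literature.NumberTheory.Automorphic.UnitaryGroup AdelicGroupData
open Summit.HodgeConjecture.HodgeConjecture.Cruxes.H413.K2E1BLSpacesU2Defs (supHeight)
open Summit.HodgeConjecture.HodgeConjecture.Cruxes.H413.K2E1CuspidalSpectrumUnitary
open Summit.HodgeConjecture.HodgeConjecture.Cruxes.H413.K2E1ConstantLineResidualU2 (span_const_le_residualSubspace span_const_le_discreteSpectrum)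
open Summit.HodgeConjecture.HodgeConjecture.Cruxes.H413.K2E1CuspFormsMeanZeroCMThree (hmean_three_of_smoothing_decay)

namespace Summit.HodgeConjecture.HodgeConjecture.Cruxes.H413.K2E1ConstantLineResidualU3

/-! ## §1 Rank-3 generic `(F, E, c)`: the constant line is residual modulo `hRc` and `hsm` -/

section Three

variable {F E : Type} [Field F] [NumberField F] [Field E] [NumberField E] [Algebra F E] {c : E ≃ₐ[F] E}
variable [MeasurableSpace (quasiSplit F E c 3).Adelic] [BorelSpace (quasiSplit F E c 3).Adelic]

omit [MeasurableSpace (quasiSplit F E c 3).Adelic] [BorelSpace (quasiSplit F E c 3).Adelic] in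
/-- **CLAUSE (i) AT `N = 3`, LETTER-FREE: `ℂ ∙ 𝟙 ≤ L²_disc(U(J₃)(F)∖U(J₃)(𝔸_F))`** (★ `span_const_le_discreteSpectrum` at the datum `quasiSplit F E c 3`). [cite: BorelJacquet1979, §4.6]
[cite: MoeglinWaldspurger1995, I.2.18] -/
theorem span_const_le_discreteSpectrum_three (μ : Measure (quasiSplit F E c 3).automorphicQuotient) [(quasiSplit F E c 3).IsAutomorphicMeasure μ] :
    (ℂ ∙ (Lp.const 2 μ (1 : ℂ) : (quasiSplit F E c 3).L2 μ)) ≤ ((quasiSplit F E c 3).discreteSpectrum μ).toSubmodule :=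
  span_const_le_discreteSpectrum _ μ

/-- **THE CONSTANT LINE IS RESIDUAL ON `U(J₃)(F)∖U(J₃)(𝔸_F)`, MODULO `hRc` AND `hsm`** (rung (ρ2)₃): `ℂ ∙ 𝟙 ≤ L²_res(U(J₃), μ, 𝔓) = L²_disc ⊓ (L²_cusp)ᗮ` for `c² = 1`, an automorphic
measure `μ`, a Haar measure `ν_G`, parabolic data `𝔓` whose `i`-th radical is the Heisenberg radical `N(𝔸)`, smoothing kernels `η, Θ ∈ C_c(G(𝔸))` of non-zero mass, the (R-c)₃ letter
`hRc` («a continuous `ψ` with vanishing constant term along `N(𝔸)` and `w₁^A·‖ψ‖` integrable has mean zero») and the decay letter `hsm` on `S_η S_Θ φ` for the cusp forms `φ` — ★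
`span_const_le_residualSubspace` ∘ ★ (R-d1)₃ `hmean_three_of_smoothing_decay`. [cite: MoeglinWaldspurger1995, I.2.18] [cite: BorelJacquet1979, §4.4–§4.6] [cite: Rogawski1990, §2.1] -/
theorem span_const_le_residualSubspace_three_of_smoothing_decay (hc : c * c = 1)
    (μ : Measure (quasiSplit F E c 3).automorphicQuotient) [(quasiSplit F E c 3).IsAutomorphicMeasure μ] (νG : Measure (quasiSplit F E c 3).Adelic) [νG.IsHaarMeasure]
    (𝔓 : (quasiSplit F E c 3).ParabolicUnipotentData) (i : 𝔓.ι) (h𝔓 : 𝔓.radical i = adelicUnipotent F E c 3) {A : ℝ}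
    (hRc : ∀ ψ : (quasiSplit F E c 3).automorphicQuotient → ℂ, Continuous ψ → ConstantTermVanishes 𝔓 ψ i →
      Integrable (fun x => ((supHeight F E c 3 x : ℝ≥0) : ℝ) ^ A * ‖ψ x‖) μ → ∫ x, ψ x ∂μ = 0)
    {η Θ : (quasiSplit F E c 3).Adelic → ℂ} (hη : Continuous η) (hηs : HasCompactSupport η) (hΘ : Continuous Θ) (hΘs : HasCompactSupport Θ)
    (hη0 : ∫ g, η g ∂νG ≠ 0) (hΘ0 : ∫ g, Θ g ∂νG ≠ 0)
    (hsm : ∀ φ ∈ (quasiSplit F E c 3).cuspForms μ 𝔓, Integrable (fun x => ((supHeight F E c 3 x : ℝ≥0) : ℝ) ^ A * ‖orbitalSmoothing νG η (orbitalSmoothing νG Θ φ) x‖) μ) :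
    (ℂ ∙ (Lp.const 2 μ (1 : ℂ) : (quasiSplit F E c 3).L2 μ)) ≤ (residualSubspace (quasiSplit F E c 3) μ 𝔓).toSubmodule :=
  span_const_le_residualSubspace _ μ 𝔓 (hmean_three_of_smoothing_decay hc μ νG 𝔓 i h𝔓 hRc hη hηs hΘ hΘs hη0 hΘ0 hsm)

/-- **ELEMENT FORM: `𝟙 ∈ L²_res(U(J₃), μ, 𝔓)`** modulo `hRc` and `hsm`. [cite: MoeglinWaldspurger1995, I.2.18] [cite: BorelJacquet1979, §4.6] -/
theorem const_one_mem_residualSubspace_three_of_smoothing_decay (hc : c * c = 1)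
    (μ : Measure (quasiSplit F E c 3).automorphicQuotient) [(quasiSplit F E c 3).IsAutomorphicMeasure μ] (νG : Measure (quasiSplit F E c 3).Adelic) [νG.IsHaarMeasure]
    (𝔓 : (quasiSplit F E c 3).ParabolicUnipotentData) (i : 𝔓.ι) (h𝔓 : 𝔓.radical i = adelicUnipotent F E c 3) {A : ℝ}
    (hRc : ∀ ψ : (quasiSplit F E c 3).automorphicQuotient → ℂ, Continuous ψ → ConstantTermVanishes 𝔓 ψ i →
      Integrable (fun x => ((supHeight F E c 3 x : ℝ≥0) : ℝ) ^ A * ‖ψ x‖) μ → ∫ x, ψ x ∂μ = 0)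
    {η Θ : (quasiSplit F E c 3).Adelic → ℂ} (hη : Continuous η) (hηs : HasCompactSupport η) (hΘ : Continuous Θ) (hΘs : HasCompactSupport Θ)
    (hη0 : ∫ g, η g ∂νG ≠ 0) (hΘ0 : ∫ g, Θ g ∂νG ≠ 0)
    (hsm : ∀ φ ∈ (quasiSplit F E c 3).cuspForms μ 𝔓, Integrable (fun x => ((supHeight F E c 3 x : ℝ≥0) : ℝ) ^ A * ‖orbitalSmoothing νG η (orbitalSmoothing νG Θ φ) x‖) μ) :
    (Lp.const 2 μ (1 : ℂ) : (quasiSplit F E c 3).L2 μ) ∈ (residualSubspace (quasiSplit F E c 3) μ 𝔓).toSubmodule :=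
  span_const_le_residualSubspace_three_of_smoothing_decay hc μ νG 𝔓 i h𝔓 hRc hη hηs hΘ hΘs hη0 hΘ0 hsm (Submodule.mem_span_singleton_self _)

end Three

/-! ## §2 The CM pair `L ∕ L⁺`: `c = complexConj`, `c² = 1` discharged -/

section CM

variable (L : Type) [Field L] [NumberField L] [IsCMField L]
variable [MeasurableSpace (quasiSplit (↥(maximalRealSubfield L)) L (IsCMField.complexConj L) 3).Adelic] [BorelSpace (quasiSplit (↥(maximalRealSubfield L)) L (IsCMField.complexConj L) 3).Adelic]

/-- **THE CONSTANT LINE IS RESIDUAL ON `U(2,1)_{L∕L⁺}(L⁺)∖U(2,1)(𝔸_{L⁺})`, MODULO `hRc` AND `hsm`** (§1 at the CM pair; `c² = 1` from Mathlib `IsCMField.complexConj_apply_apply`).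
[cite: MoeglinWaldspurger1995, I.2.18] [cite: Rogawski1990, §13.5] -/
theorem span_const_le_residualSubspace_cm_three_of_smoothing_decay
    (μ : Measure (quasiSplit (↥(maximalRealSubfield L)) L (IsCMField.complexConj L) 3).automorphicQuotient)
    [(quasiSplit (↥(maximalRealSubfield L)) L (IsCMField.complexConj L) 3).IsAutomorphicMeasure μ]
    (νG : Measure (quasiSplit (↥(maximalRealSubfield L)) L (IsCMField.complexConj L) 3).Adelic) [νG.IsHaarMeasure]
    (𝔓 : (quasiSplit (↥(maximalRealSubfield L)) L (IsCMField.complexConj L) 3).ParabolicUnipotentData) (i : 𝔓.ι)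
    (h𝔓 : 𝔓.radical i = adelicUnipotent (↥(maximalRealSubfield L)) L (IsCMField.complexConj L) 3) {A : ℝ}
    (hRc : ∀ ψ : (quasiSplit (↥(maximalRealSubfield L)) L (IsCMField.complexConj L) 3).automorphicQuotient → ℂ, Continuous ψ → ConstantTermVanishes 𝔓 ψ i →
      Integrable (fun x => ((supHeight (↥(maximalRealSubfield L)) L (IsCMField.complexConj L) 3 x : ℝ≥0) : ℝ) ^ A * ‖ψ x‖) μ → ∫ x, ψ x ∂μ = 0)
    {η Θ : (quasiSplit (↥(maximalRealSubfield L)) L (IsCMField.complexConj L) 3).Adelic → ℂ} (hη : Continuous η) (hηs : HasCompactSupport η) (hΘ : Continuous Θ) (hΘs : HasCompactSupport Θ)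
    (hη0 : ∫ g, η g ∂νG ≠ 0) (hΘ0 : ∫ g, Θ g ∂νG ≠ 0)
    (hsm : ∀ φ ∈ (quasiSplit (↥(maximalRealSubfield L)) L (IsCMField.complexConj L) 3).cuspForms μ 𝔓,
      Integrable (fun x => ((supHeight (↥(maximalRealSubfield L)) L (IsCMField.complexConj L) 3 x : ℝ≥0) : ℝ) ^ A * ‖orbitalSmoothing νG η (orbitalSmoothing νG Θ φ) x‖) μ) :
    (ℂ ∙ (Lp.const 2 μ (1 : ℂ) : (quasiSplit (↥(maximalRealSubfield L)) L (IsCMField.complexConj L) 3).L2 μ)) ≤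
      (residualSubspace (quasiSplit (↥(maximalRealSubfield L)) L (IsCMField.complexConj L) 3) μ 𝔓).toSubmodule :=
  span_const_le_residualSubspace_three_of_smoothing_decay
    (AlgEquiv.ext fun x => by rw [AlgEquiv.mul_apply, AlgEquiv.one_apply, IsCMField.complexConj_apply_apply]) μ νG 𝔓 i h𝔓 hRc hη hηs hΘ hΘs hη0 hΘ0 hsm

end CM

end Summit.HodgeConjecture.HodgeConjecture.Cruxes.H413.K2E1ConstantLineResidualU3

end
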